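import Summits.AnomalousDissipation.AnomalousDissipation.Theorems.MomentParityQuarticGateFourierDictionary

/-!
# Complexified reduction for the axial Casimir stubs (line `axis-sectors` of crux `MomentParity.QuarticGate`), I

By the Fourier dictionary (`…FourierDictionary*.lean`) the Casimir clause and the observables of the
stubs `stub_noAxialCubicCasimir` / `stub_axialQuadRigidity` are REAL polynomial identities in the
admissible (conjugate-symmetric, transversal, supported in the ball) families `c = coef u`. The
combinatorial core runs on COMPLEX families without the reality condition, with conjugation-free
ℂ-(bi)linear pairings. Here, as explicit sums (no definitions):
* `sum_sum_mul_apply_neg_eq_ofReal`: for conjugate-symmetric `a, b` on a symmetric `S`,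
  `Σ_{k∈S} Σᵢ a k i · b (-k) i = ↑(Σ_{k∈S} Re ⟪a k, b k⟫_ℂ)` (bilinear = sesquilinear, and real);
* the COORDINATE functional `ℓ_v(c) = Σ_{k∈S*} Σᵢ c k i · v (-k) i`: linear (`ell_add_left`,
  `ell_smul_left`), `= ↑(Σ Re⟪c k, v k⟫)` on admissible `c` (`ell_eq_ofReal`), `↑(u, g) = ℓ_ĝ(coef u)`
  (`ofReal_pairing_eq_ell`);
* the BRACKET form `B_v(c, c') = Σ_{k∈S} Σᵢ (convectionCoeff S c v k) i · c' (-k) i`, `S = freqBall N`: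
  bilinear (`bracketForm_add/smul_left/right`), `=` the real Euler bracket sum on admissible `c`
  (`bracketForm_eq_ofReal`), `↑⟨B(u), g⟩ = B_ĝ(coef u, coef u)` (`ofReal_euler_bracket_eq_bracketForm`,
  `ofReal_euler_bracket_polyGrad_eq`);
* SINGLE MODES `δ_p x = Pi.single p x`: `convectionCoeff_single_left`, `bracketForm_single_single`, and
  the PAIR TRANSFER `bracketForm_single_single_symm`;
* REAL FORM: `c = a + i b` with admissible `a, b` (`exists_admissible_decomposition`),
  `admissible_real_combination`.
-/

namespace Summit.AnomalousDissipation.AnomalousDissipation.Theorems.MomentParityQuarticGate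

open MeasureTheory Filter
open scoped InnerProductSpace RealInnerProductSpace ComplexConjugate ENNReal
open Literature.Analysis.FunctionSpaces Literature.Analysis.FluidPDE
open Summit.AnomalousDissipation.AnomalousDissipation.Theses.MomentParity
open Summit.AnomalousDissipation.AnomalousDissipation.Theorems.QuarticGate.Negative

-- `Summit.<Summit>.<Problem>` is the tree's mandated summit-side namespace (CONVENTIONS §2); for this
-- single-conjunct summit the two coincide, so the duplicate is deliberate.
set_option linter.dupNamespace false

noncomputable section

/-! ## Bilinear = sesquilinear on conjugate-symmetric families -/

section Basic

/-- `⟪conj x, conj y⟫_ℂ = ⟪y, x⟫_ℂ`. [folklore] -/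
theorem inner_conjVec_conjVec (x y : EuclideanSpace ℂ (Fin 3)) :
    inner ℂ (EuclideanSpace.conjVec x) (EuclideanSpace.conjVec y) = inner ℂ y x := by
  simp only [PiLp.inner_apply, RCLike.inner_apply, EuclideanSpace.conjVec_apply, Complex.conj_conj]
  exact Finset.sum_congr rfl fun i _ => mul_comm _ _

/-- The bilinear coordinate sum against the reflected family is a Hermitian inner product when the
second family is conjugate symmetric: `Σᵢ a k i · b (-k) i = ⟪b k, a k⟫_ℂ`. [folklore] -/
theorem sum_mul_apply_neg_eq_inner {a b : (Fin 3 → ℤ) → EuclideanSpace ℂ (Fin 3)}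
    (hb : Torus.IsConjSymm b) (k : Fin 3 → ℤ) :
    ∑ i, a k i * b (-k) i = inner ℂ (b k) (a k) := by
  rw [hb k]
  simp only [PiLp.inner_apply, RCLike.inner_apply, EuclideanSpace.conjVec_apply]

/-- On a symmetric frequency set, `Σ_{k∈S} ⟪b k, a k⟫_ℂ` is REAL for conjugate-symmetric `a, b`
(the terms at `k` and `-k` are complex conjugates). [folklore] -/
theorem conj_sum_inner_eq_self {S : Finset (Fin 3 → ℤ)} (hS : ∀ k ∈ S, -k ∈ S)
    {a b : (Fin 3 → ℤ) → EuclideanSpace ℂ (Fin 3)} (ha : Torus.IsConjSymm a) (hb : Torus.IsConjSymm b) :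
    (starRingEnd ℂ) (∑ k ∈ S, inner ℂ (b k) (a k)) = ∑ k ∈ S, inner ℂ (b k) (a k) := by
  rw [map_sum]
  calc ∑ k ∈ S, (starRingEnd ℂ) (inner ℂ (b k) (a k)) = ∑ k ∈ S, inner ℂ (a k) (b k) :=
        Finset.sum_congr rfl fun k _ => inner_conj_symm _ _
    _ = ∑ k ∈ S, inner ℂ (a (-k)) (b (-k)) :=
        Finset.sum_nbij' (fun k => -k) (fun k => -k) (fun k hk => hS k hk) (fun k hk => hS k hk)
          (fun k _ => neg_neg k) (fun k _ => neg_neg k) (fun k _ => by rw [neg_neg])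
    _ = ∑ k ∈ S, inner ℂ (b k) (a k) :=
        Finset.sum_congr rfl fun k _ => by rw [ha k, hb k, inner_conjVec_conjVec]

/-- **Bilinear = sesquilinear on admissible families.** For conjugate-symmetric `a, b` on a symmetric
`S`: `Σ_{k∈S} Σᵢ a k i · b (-k) i = ↑(Σ_{k∈S} Re ⟪a k, b k⟫_ℂ)` — the conjugation-free bilinear pairing
coincides with the real part of the Hermitian one, and is real. [folklore] -/
theorem sum_sum_mul_apply_neg_eq_ofReal {S : Finset (Fin 3 → ℤ)} (hS : ∀ k ∈ S, -k ∈ S)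
    {a b : (Fin 3 → ℤ) → EuclideanSpace ℂ (Fin 3)} (ha : Torus.IsConjSymm a) (hb : Torus.IsConjSymm b) :
    ∑ k ∈ S, ∑ i, a k i * b (-k) i = (((∑ k ∈ S, (inner ℂ (a k) (b k)).re : ℝ)) : ℂ) := by
  simp_rw [sum_mul_apply_neg_eq_inner hb]
  have hreal := conj_sum_inner_eq_self hS ha hb
  rw [Complex.conj_eq_iff_re] at hreal
  rw [← hreal, Complex.re_sum]
  congr 1
  refine Finset.sum_congr rfl fun k _ => ?_
  rw [← inner_conj_symm, Complex.conj_re]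

end Basic

/-! ## The coordinate functional `ℓ_v(c) = Σ_{k∈S*} Σᵢ c k i · v (-k) i` -/

section Ell

variable {N : ℕ}

/-- `ℓ_v` is additive in `c`. [folklore] -/
theorem ell_add_left (S : Finset (Fin 3 → ℤ)) (a b v : (Fin 3 → ℤ) → EuclideanSpace ℂ (Fin 3)) :
    ∑ k ∈ S, ∑ i, (a + b) k i * v (-k) i = ∑ k ∈ S, ∑ i, a k i * v (-k) i + ∑ k ∈ S, ∑ i, b k i * v (-k) i := by
  rw [← Finset.sum_add_distrib]
  refine Finset.sum_congr rfl fun k _ => ?_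
  rw [← Finset.sum_add_distrib]
  refine Finset.sum_congr rfl fun i _ => ?_
  simp only [Pi.add_apply, PiLp.add_apply]
  ring

/-- `ℓ_v` is homogeneous in `c`. [folklore] -/
theorem ell_smul_left (S : Finset (Fin 3 → ℤ)) (z : ℂ) (a v : (Fin 3 → ℤ) → EuclideanSpace ℂ (Fin 3)) :
    ∑ k ∈ S, ∑ i, (z • a) k i * v (-k) i = z * ∑ k ∈ S, ∑ i, a k i * v (-k) i := by
  rw [Finset.mul_sum]
  refine Finset.sum_congr rfl fun k _ => ?_
  rw [Finset.mul_sum]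
  refine Finset.sum_congr rfl fun i _ => ?_
  simp only [Pi.smul_apply, PiLp.smul_apply, smul_eq_mul]
  ring

/-- **`ℓ_v` on admissible families is the real pairing sum**: for conjugate-symmetric `c` and `v`,
`Σ_{k∈S*} Σᵢ c k i · v (-k) i = ↑(Σ_{k∈S*} Re ⟪c k, v k⟫_ℂ)` (`S* = (freqBall N).erase 0`). [folklore] -/
theorem ell_eq_ofReal {c v : (Fin 3 → ℤ) → EuclideanSpace ℂ (Fin 3)} (hc : Torus.IsConjSymm c)
    (hv : Torus.IsConjSymm v) :
    ∑ k ∈ (Torus.freqBall N).erase 0, ∑ i, c k i * v (-k) i =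
      (((∑ k ∈ (Torus.freqBall N).erase 0, (inner ℂ (c k) (v k)).re : ℝ)) : ℂ) :=
  sum_sum_mul_apply_neg_eq_ofReal neg_mem_freqBall_erase_zero hc hv

/-- **The pairing as a bilinear functional of the coefficients**: for `u ∈ H` and a band test `g`,
`↑(u, g) = ℓ_{ĝ}(coef u) = Σ_{k∈S*} Σᵢ û k i · ĝ (-k) i`. [folklore] -/
theorem ofReal_pairing_eq_ell (u : Torus.energySpace (Fin 3))
    {g : UnitAddTorus (Fin 3) → EuclideanSpace ℝ (Fin 3)} (hg : IsBandTest N g) :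
    ((Torus.pairing u.1 g : ℝ) : ℂ) = ∑ k ∈ (Torus.freqBall N).erase 0, ∑ i, coef u k i * tcoef g (-k) i := by
  rw [pairing_eq_sum_coef_of_isBandTest u hg, ell_eq_ofReal (isConjSymm_coef u) (isConjSymm_tcoef hg.1.integrable)]

end Ell

/-! ## The bracket form `B_v(c, c') = Σ_{k∈S} Σᵢ (convectionCoeff S c v k) i · c' (-k) i` -/

section BracketForm

variable {N : ℕ}

/-- `B_v` is additive in the first slot. [folklore] -/
theorem bracketForm_add_left (S : Finset (Fin 3 → ℤ)) (a b v c' : (Fin 3 → ℤ) → EuclideanSpace ℂ (Fin 3)) :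
    ∑ k ∈ S, ∑ i, (Torus.convectionCoeff S (a + b) v k) i * c' (-k) i =
      ∑ k ∈ S, ∑ i, (Torus.convectionCoeff S a v k) i * c' (-k) i +
        ∑ k ∈ S, ∑ i, (Torus.convectionCoeff S b v k) i * c' (-k) i := by
  rw [← Finset.sum_add_distrib]
  refine Finset.sum_congr rfl fun k _ => ?_
  rw [← Finset.sum_add_distrib, Torus.convectionCoeff_add_left]
  refine Finset.sum_congr rfl fun i _ => ?_
  simp only [PiLp.add_apply]
  ring

/-- `B_v` is homogeneous in the first slot. [folklore] -/
theorem bracketForm_smul_left (S : Finset (Fin 3 → ℤ)) (z : ℂ) (a v c' : (Fin 3 → ℤ) → EuclideanSpace ℂ (Fin 3)) :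
    ∑ k ∈ S, ∑ i, (Torus.convectionCoeff S (z • a) v k) i * c' (-k) i =
      z * ∑ k ∈ S, ∑ i, (Torus.convectionCoeff S a v k) i * c' (-k) i := by
  rw [Finset.mul_sum]
  refine Finset.sum_congr rfl fun k _ => ?_
  rw [Finset.mul_sum, Torus.convectionCoeff_smul_left]
  refine Finset.sum_congr rfl fun i _ => ?_
  simp only [PiLp.smul_apply, smul_eq_mul]
  ring

/-- `B_v` is additive in the second slot. [folklore] -/
theorem bracketForm_add_right (S : Finset (Fin 3 → ℤ)) (a v b b' : (Fin 3 → ℤ) → EuclideanSpace ℂ (Fin 3)) :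
    ∑ k ∈ S, ∑ i, (Torus.convectionCoeff S a v k) i * (b + b') (-k) i =
      ∑ k ∈ S, ∑ i, (Torus.convectionCoeff S a v k) i * b (-k) i +
        ∑ k ∈ S, ∑ i, (Torus.convectionCoeff S a v k) i * b' (-k) i := by
  rw [← Finset.sum_add_distrib]
  refine Finset.sum_congr rfl fun k _ => ?_
  rw [← Finset.sum_add_distrib]
  refine Finset.sum_congr rfl fun i _ => ?_
  simp only [Pi.add_apply, PiLp.add_apply]
  ring

/-- `B_v` is homogeneous in the second slot. [folklore] -/
theorem bracketForm_smul_right (S : Finset (Fin 3 → ℤ)) (z : ℂ) (a v b : (Fin 3 → ℤ) → EuclideanSpace ℂ (Fin 3)) :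
    ∑ k ∈ S, ∑ i, (Torus.convectionCoeff S a v k) i * (z • b) (-k) i =
      z * ∑ k ∈ S, ∑ i, (Torus.convectionCoeff S a v k) i * b (-k) i := by
  rw [Finset.mul_sum]
  refine Finset.sum_congr rfl fun k _ => ?_
  rw [Finset.mul_sum]
  refine Finset.sum_congr rfl fun i _ => ?_
  simp only [Pi.smul_apply, PiLp.smul_apply, smul_eq_mul]
  ring

/-- **`B_v(c, c)` on admissible families is the real Euler bracket sum**: for conjugate-symmetric `c`
and `v`, `Σ_{k∈S} Σᵢ (convectionCoeff S c v k) i · c (-k) i = ↑(Σ_{k∈S} Re ⟪convectionCoeff S c v k, c k⟫_ℂ)`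
(`S = freqBall N`; the convection symbol of conjugate-symmetric families is conjugate symmetric). [folklore] -/
theorem bracketForm_eq_ofReal {c v : (Fin 3 → ℤ) → EuclideanSpace ℂ (Fin 3)} (hc : Torus.IsConjSymm c)
    (hv : Torus.IsConjSymm v) :
    ∑ k ∈ Torus.freqBall N, ∑ i, (Torus.convectionCoeff (Torus.freqBall N) c v k) i * c (-k) i =
      (((∑ k ∈ Torus.freqBall N,
        (inner ℂ (Torus.convectionCoeff (Torus.freqBall N) c v k) (c k)).re : ℝ)) : ℂ) :=
  sum_sum_mul_apply_neg_eq_ofReal Torus.neg_mem_freqBall_of_mem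
    (hc.convectionCoeff Torus.neg_mem_freqBall_of_mem hv) hc

/-- **The Euler bracket as a bilinear form of the coefficients**: for a level-`N` field `u` and a band
test `g`, `↑⟨B(u), g⟩ = B_{ĝ}(coef u, coef u)`. [folklore] -/
theorem ofReal_euler_bracket_eq_bracketForm {u : Torus.energySpace (Fin 3)} (hu : IsLevel N u)
    {g : UnitAddTorus (Fin 3) → EuclideanSpace ℝ (Fin 3)} (hg : IsBandTest N g) :
    ((Torus.nsGeneratorPairing (d := Fin 3) 0 0 u g : ℝ) : ℂ) =
      ∑ k ∈ Torus.freqBall N, ∑ i, (Torus.convectionCoeff (Torus.freqBall N) (coef u) (tcoef g) k) i * coef u (-k) i := by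
  rw [euler_bracket_eq_sum_coef_of_isBandTest hu hg,
    bracketForm_eq_ofReal (isConjSymm_coef u) (isConjSymm_tcoef hg.1.integrable)]

/-- **The Euler bracket of a polynomial observable, complexified**: for a level-`N` field `u`, band
tests `g` and `P`, `↑⟨B(u), ∇p(u)⟩ = Σᵢ ↑(∂ᵢP((u,g))) · B_{ĝᵢ}(coef u, coef u)`. [folklore] -/
theorem ofReal_euler_bracket_polyGrad_eq {u : Torus.energySpace (Fin 3)} (hu : IsLevel N u) {m : ℕ}
    (g : Fin m → UnitAddTorus (Fin 3) → EuclideanSpace ℝ (Fin 3)) (hg : ∀ i, IsBandTest N (g i))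
    (P : MvPolynomial (Fin m) ℝ) :
    ((Torus.nsGeneratorPairing (d := Fin 3) 0 0 u (polyGrad g P u) : ℝ) : ℂ) =
      ∑ i, ((MvPolynomial.eval (fun j => Torus.pairing u.1 (g j)) (MvPolynomial.pderiv i P) : ℝ) : ℂ) *
        ∑ k ∈ Torus.freqBall N, ∑ i', (Torus.convectionCoeff (Torus.freqBall N) (coef u) (tcoef (g i)) k) i' *
          coef u (-k) i' := by
  rw [euler_bracket_polyGrad_eq_sum_eval_mul u g (fun i => (hg i).1) P]
  push_cast
  exact Finset.sum_congr rfl fun i _ => by rw [ofReal_euler_bracket_eq_bracketForm hu (hg i)]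

end BracketForm

/-! ## Single modes `δ_p x = Pi.single p x` -/

section Single

variable {N : ℕ}

/-- **The convection symbol with a single advecting mode**: for `p ∈ S`,
`convectionCoeff S (δ_p x) v k = Σ_{m∈S, p+m=k} (2πi (x · m)) • v m`. [folklore] -/
theorem convectionCoeff_single_left {S : Finset (Fin 3 → ℤ)} {p : Fin 3 → ℤ} (hp : p ∈ S)
    (x : EuclideanSpace ℂ (Fin 3)) (v : (Fin 3 → ℤ) → EuclideanSpace ℂ (Fin 3)) (k : Fin 3 → ℤ) :
    Torus.convectionCoeff S (Pi.single p x) v k =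
      ∑ m ∈ S, if p + m = k then (2 * Real.pi * Complex.I * ∑ j, x j * (m j : ℂ)) • v m else 0 := by
  rw [Torus.convectionCoeff_def, Finset.sum_eq_single p (fun l _ hl => Finset.sum_eq_zero fun m _ => by
      simp [Pi.single_eq_of_ne hl]) (fun h => (h hp).elim)]
  simp only [Pi.single_eq_same]

/-- **The bracket form on two single modes**: for `p, q ∈ S = freqBall N`,
`B_v(δ_p x, δ_q y) = (2πi (x · (-(p+q)))) · Σᵢ v(-(p+q)) i · y i` if `p + q ∈ S`, and `0` otherwise
(the only contributing advected frequency is `m = -(p+q)`). [folklore] -/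
theorem bracketForm_single_single {p q : Fin 3 → ℤ} (hp : p ∈ Torus.freqBall N) (hq : q ∈ Torus.freqBall N)
    (x y : EuclideanSpace ℂ (Fin 3)) (v : (Fin 3 → ℤ) → EuclideanSpace ℂ (Fin 3)) :
    ∑ k ∈ Torus.freqBall N, ∑ i, (Torus.convectionCoeff (Torus.freqBall N) (Pi.single p x) v k) i *
        (Pi.single q y : (Fin 3 → ℤ) → EuclideanSpace ℂ (Fin 3)) (-k) i =
      if p + q ∈ Torus.freqBall N then
        (2 * Real.pi * Complex.I * ∑ j, x j * ((-(p + q)) j : ℂ)) * ∑ i, v (-(p + q)) i * y i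
      else 0 := by
  classical
  -- only `k = -q` contributes
  have hnegq : -q ∈ Torus.freqBall N := Torus.neg_mem_freqBall_of_mem q hq
  rw [Finset.sum_eq_single (-q) (fun k _ hk => Finset.sum_eq_zero fun i _ => by
      rw [show (Pi.single q y : (Fin 3 → ℤ) → EuclideanSpace ℂ (Fin 3)) (-k) = 0 from
        Pi.single_eq_of_ne (fun h => hk (by rw [← h, neg_neg])) _]
      simp) (fun h => (h hnegq).elim)]
  rw [neg_neg, Pi.single_eq_same, convectionCoeff_single_left hp]
  -- only `m = -(p+q)` contributes
  have hiff : ∀ m : Fin 3 → ℤ, p + m = -q ↔ m = -(p + q) := fun m => by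
    constructor
    · intro h; rw [neg_add, ← h]; abel
    · intro h; rw [h, neg_add]; abel
  simp_rw [hiff]
  rw [Finset.sum_ite_eq']
  simp only [Torus.neg_mem_freqBall]
  split_ifs with hmem
  · simp only [PiLp.smul_apply, smul_eq_mul, Finset.mul_sum]
    exact Finset.sum_congr rfl fun i _ => mul_assoc _ _ _
  · simp

/-- **PAIR TRANSFER — the symmetrised bracket form on two transversal single modes**: for
`p, q ∈ S = freqBall N`, `x ⊥ p`, `y ⊥ q` (bilinearly),
`B_v(δ_p x, δ_q y) + B_v(δ_q y, δ_p x) = -(2πi) Σᵢ v(-(p+q)) i · ((x·q) yᵢ + (y·p) xᵢ)` if `p + q ∈ S`,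
else `0`: the pair `{p, q}` feeds the frequency `p + q` through the transfer vector
`(x·q) y + (y·p) x`. [folklore] -/
theorem bracketForm_single_single_symm {p q : Fin 3 → ℤ} (hp : p ∈ Torus.freqBall N)
    (hq : q ∈ Torus.freqBall N) {x y : EuclideanSpace ℂ (Fin 3)} (hx : ∑ j, (p j : ℂ) * x j = 0)
    (hy : ∑ j, (q j : ℂ) * y j = 0) (v : (Fin 3 → ℤ) → EuclideanSpace ℂ (Fin 3)) :
    (∑ k ∈ Torus.freqBall N, ∑ i, (Torus.convectionCoeff (Torus.freqBall N) (Pi.single p x) v k) i *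
        (Pi.single q y : (Fin 3 → ℤ) → EuclideanSpace ℂ (Fin 3)) (-k) i) +
      ∑ k ∈ Torus.freqBall N, ∑ i, (Torus.convectionCoeff (Torus.freqBall N) (Pi.single q y) v k) i *
        (Pi.single p x : (Fin 3 → ℤ) → EuclideanSpace ℂ (Fin 3)) (-k) i =
      if p + q ∈ Torus.freqBall N then
        -(2 * Real.pi * Complex.I) * ∑ i, v (-(p + q)) i *
          ((∑ j, x j * (q j : ℂ)) * y i + (∑ j, y j * (p j : ℂ)) * x i)
      else 0 := by
  rw [bracketForm_single_single hp hq, bracketForm_single_single hq hp, add_comm q p]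
  have hxp : ∑ j, x j * (p j : ℂ) = 0 := by
    rw [← hx]; exact Finset.sum_congr rfl fun j _ => mul_comm _ _
  have hyq : ∑ j, y j * (q j : ℂ) = 0 := by
    rw [← hy]; exact Finset.sum_congr rfl fun j _ => mul_comm _ _
  have hx' : ∑ j, x j * ((-(p + q)) j : ℂ) = -∑ j, x j * (q j : ℂ) := by
    have : ∀ j, x j * ((-(p + q)) j : ℂ) = -(x j * (p j : ℂ)) - x j * (q j : ℂ) := fun j => by
      simp only [Pi.neg_apply, Pi.add_apply]; push_cast; ring
    simp_rw [this, Finset.sum_sub_distrib, Finset.sum_neg_distrib, hxp, neg_zero, zero_sub]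
  have hy' : ∑ j, y j * ((-(p + q)) j : ℂ) = -∑ j, y j * (p j : ℂ) := by
    have : ∀ j, y j * ((-(p + q)) j : ℂ) = -(y j * (p j : ℂ)) - y j * (q j : ℂ) := fun j => by
      simp only [Pi.neg_apply, Pi.add_apply]; push_cast; ring
    simp_rw [this, Finset.sum_sub_distrib, Finset.sum_neg_distrib, hyq, sub_zero]
  split_ifs with hmem
  · rw [hx', hy', Finset.mul_sum, Finset.mul_sum, Finset.mul_sum, ← Finset.sum_add_distrib]
    exact Finset.sum_congr rfl fun i _ => by ring
  · simp

end Single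

/-! ## Real form: `C_N = A_N ⊕ i A_N` -/

section RealForm

/-- **Every complex family is `a + i b` with conjugate-symmetric `a, b`**, which are transversal on /
supported in a symmetric `S` when the family is: `a k = ½ (c k + conj c (-k))`,
`b k = -i/2 · (c k - conj c (-k))`. [folklore] -/
theorem exists_admissible_decomposition {S : Finset (Fin 3 → ℤ)} (hS : ∀ k ∈ S, -k ∈ S)
    (c : (Fin 3 → ℤ) → EuclideanSpace ℂ (Fin 3)) (hT : Torus.IsTransversal S c) (hsupp : ∀ k ∉ S, c k = 0) :
    ∃ a b : (Fin 3 → ℤ) → EuclideanSpace ℂ (Fin 3),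
      Torus.IsConjSymm a ∧ Torus.IsConjSymm b ∧ Torus.IsTransversal S a ∧ Torus.IsTransversal S b ∧
      (∀ k ∉ S, a k = 0) ∧ (∀ k ∉ S, b k = 0) ∧ ∀ k, c k = a k + Complex.I • b k := by
  have hS' : ∀ k, k ∉ S → -k ∉ S := fun k hk hnk => hk (by simpa using hS (-k) hnk)
  -- transversality of the reflected conjugate
  have hTc : ∀ k ∈ S, ∑ j, (k j : ℂ) * (EuclideanSpace.conjVec (c (-k))) j = 0 := fun k hk => by
    have h := congrArg (starRingEnd ℂ) (hT (-k) (hS k hk))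
    rw [map_sum, map_zero] at h
    rw [← neg_eq_zero, ← h, ← Finset.sum_neg_distrib]
    refine Finset.sum_congr rfl fun j _ => ?_
    simp only [EuclideanSpace.conjVec_apply, map_mul, Pi.neg_apply, Int.cast_neg, map_neg, map_intCast]
    ring
  refine ⟨fun k => (2⁻¹ : ℂ) • (c k + EuclideanSpace.conjVec (c (-k))),
    fun k => (-(Complex.I / 2)) • (c k - EuclideanSpace.conjVec (c (-k))), ?_, ?_, ?_, ?_, ?_, ?_, ?_⟩
  · intro k
    dsimp only
    rw [neg_neg, EuclideanSpace.conjVec_smul, EuclideanSpace.conjVec_add, EuclideanSpace.conjVec_conjVec,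
      add_comm (EuclideanSpace.conjVec (c k))]
    congr 1
    rw [map_inv₀, map_ofNat]
  · intro k
    dsimp only
    rw [neg_neg, EuclideanSpace.conjVec_smul, EuclideanSpace.conjVec_sub, EuclideanSpace.conjVec_conjVec]
    have hI : (starRingEnd ℂ) (-(Complex.I / 2)) = Complex.I / 2 := by
      simp only [map_neg, map_div₀, Complex.conj_I, map_ofNat, neg_div, neg_neg]
    rw [hI, ← neg_sub (c (-k)) (EuclideanSpace.conjVec (c k)), smul_neg, neg_smul]
  · intro k hk
    simp only [PiLp.smul_apply, PiLp.add_apply, smul_eq_mul]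
    calc ∑ j, (k j : ℂ) * (2⁻¹ * (c k j + (EuclideanSpace.conjVec (c (-k))) j))
        = 2⁻¹ * (∑ j, (k j : ℂ) * c k j + ∑ j, (k j : ℂ) * (EuclideanSpace.conjVec (c (-k))) j) := by
          rw [← Finset.sum_add_distrib, Finset.mul_sum]
          exact Finset.sum_congr rfl fun j _ => by ring
      _ = 0 := by rw [hT k hk, hTc k hk]; ring
  · intro k hk
    simp only [PiLp.smul_apply, PiLp.sub_apply, smul_eq_mul]
    calc ∑ j, (k j : ℂ) * (-(Complex.I / 2) * (c k j - (EuclideanSpace.conjVec (c (-k))) j))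
        = -(Complex.I / 2) * (∑ j, (k j : ℂ) * c k j - ∑ j, (k j : ℂ) * (EuclideanSpace.conjVec (c (-k))) j) := by
          rw [← Finset.sum_sub_distrib, Finset.mul_sum]
          exact Finset.sum_congr rfl fun j _ => by ring
      _ = 0 := by rw [hT k hk, hTc k hk]; ring
  · intro k hk
    simp only [hsupp k hk, hsupp (-k) (hS' k hk), EuclideanSpace.conjVec_zero, add_zero, smul_zero]
  · intro k hk
    simp only [hsupp k hk, hsupp (-k) (hS' k hk), EuclideanSpace.conjVec_zero, sub_zero, smul_zero]
  · intro k
    dsimp only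
    rw [smul_smul, show Complex.I * -(Complex.I / 2) = (2⁻¹ : ℂ) by
      rw [mul_neg, ← mul_div_assoc, Complex.I_mul_I]; ring]
    rw [← smul_add, add_add_sub_cancel, ← two_smul ℂ (c k), smul_smul]
    norm_num

/-- **Real combinations of admissible families are admissible.** [folklore] -/
theorem admissible_real_combination {S : Finset (Fin 3 → ℤ)} {a b : (Fin 3 → ℤ) → EuclideanSpace ℂ (Fin 3)}
    (ha : Torus.IsConjSymm a) (hb : Torus.IsConjSymm b) (hTa : Torus.IsTransversal S a)
    (hTb : Torus.IsTransversal S b) (hsa : ∀ k ∉ S, a k = 0) (hsb : ∀ k ∉ S, b k = 0) (s t : ℝ) :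
    Torus.IsConjSymm (fun k => (s : ℂ) • a k + (t : ℂ) • b k) ∧
      Torus.IsTransversal S (fun k => (s : ℂ) • a k + (t : ℂ) • b k) ∧
      ∀ k ∉ S, (s : ℂ) • a k + (t : ℂ) • b k = 0 := by
  refine ⟨?_, ?_, ?_⟩
  · intro k
    dsimp only
    rw [ha k, hb k, EuclideanSpace.conjVec_add, EuclideanSpace.conjVec_smul, EuclideanSpace.conjVec_smul,
      Complex.conj_ofReal, Complex.conj_ofReal]
  · intro k hk
    simp only [PiLp.add_apply, PiLp.smul_apply, smul_eq_mul]
    calc ∑ j, (k j : ℂ) * ((s : ℂ) * a k j + (t : ℂ) * b k j)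
        = (s : ℂ) * ∑ j, (k j : ℂ) * a k j + (t : ℂ) * ∑ j, (k j : ℂ) * b k j := by
          rw [Finset.mul_sum, Finset.mul_sum, ← Finset.sum_add_distrib]
          exact Finset.sum_congr rfl fun j _ => by ring
      _ = 0 := by rw [hTa k hk, hTb k hk]; ring
  · intro k hk
    rw [hsa k hk, hsb k hk, smul_zero, smul_zero, add_zero]

end RealForm

end

/-! ## Registered sub-goal (summary) -/

/-- **Registered sub-goal `cubicComplexify_pairTransfer` (summary of this file — the pair transfer in
the conjugation-free bracket form)**: for single modes `δ_p x`, `δ_q y` (`p, q ∈ S = freqBall N`,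
`x ⊥ p`, `y ⊥ q` bilinearly) and any advected family `v`,
`B_v(δ_p x, δ_q y) + B_v(δ_q y, δ_p x) = -(2πi) Σᵢ v(-(p+q)) i ((x·q) yᵢ + (y·p) xᵢ)` if `p + q ∈ S`, else `0`,
where `B_v(c, c') = Σ_{k∈S} Σᵢ (convectionCoeff S c v k) i · c' (-k) i`. [folklore] -/
theorem cubicComplexify_pairTransfer : ∀ (N : ℕ) (p q : Fin 3 → ℤ) (x y : EuclideanSpace ℂ (Fin 3)) (v : (Fin 3 → ℤ) → EuclideanSpace ℂ (Fin 3)), p ∈ Torus.freqBall N → q ∈ Torus.freqBall N → ∑ j, (p j : ℂ) * x j = 0 → ∑ j, (q j : ℂ) * y j = 0 → (∑ k ∈ Torus.freqBall N, ∑ i, (Torus.convectionCoeff (Torus.freqBall N) (Pi.single p x) v k) i * (Pi.single q y : (Fin 3 → ℤ) → EuclideanSpace ℂ (Fin 3)) (-k) i) + ∑ k ∈ Torus.freqBall N, ∑ i, (Torus.convectionCoeff (Torus.freqBall N) (Pi.single q y) v k) i * (Pi.single p x : (Fin 3 → ℤ) → EuclideanSpace ℂ (Fin 3)) (-k) i =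 if p + q ∈ Torus.freqBall N then -(2 * Real.pi * Complex.I) * ∑ i, v (-(p + q)) i * ((∑ j, x j * (q j : ℂ)) * y i + (∑ j, y j * (p j : ℂ)) * x i) else 0 :=
  fun _ _ _ _ _ v hp hq hx hy => bracketForm_single_single_symm hp hq hx hy v

end Summit.AnomalousDissipation.AnomalousDissipation.Theorems.MomentParityQuarticGate
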